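import Summits.AtomisticToContinuum.Crystallization.Theorems.OverbindingBudgetAffineCompressedCutPatch
import Summits.AtomisticToContinuum.Crystallization.Theorems.OverbindingBudgetAffineCompressedCutBudget

/-!
# Overbinding budget — compressed cut: R4 «LR(r₁)» VIII — THE LENS LEMMA (fcc completion + `D₃` parity decoding)

Record: route `OverbindingBudget`, crux `RobustDefectLimitWindows` (stmt-AtomisticToContinuum-31280); open leaf NS♭₂ ⟸ 79K ⟸ LR(r₁); R4 «LR(r₁)»,
obligation (O-D) of memo NODE-g81-Budget §4 (critic rows 1443 (C), 1448): the LENS LEMMA of the exclusivity step O7, by the route (γ) declared on the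
bus (PLAN decomp-a2c-lens-4 g82, 2026-09-03): «fcc COMPLETION + `D₃` PARITY DECODING» — neither a Delaunay tiling (α) nor a rational grid (β).

THE STATEMENT (`lens`, §2).  Two consecutive labelled layers of the stack are `a₀ + H` and `a₀ + c + H`, where `H = {x : InLayer x}` is the `(1,1,1)`
layer lattice (`Σ x = 0`, coordinates `≡ 0 (mod 3)`) and `c = capv 1 ε (1,1,−2) = (2,2,2) + ε(1,1,−2)` (`ε = ±1`) is the cap between them (the run's
offset recursion `offs (m+1) = offs m + ε_m (1,1,−2)`, `…RunBox.stack_run_box`).  Every model point `p` whose height lies between the two layers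
(`√18·(p₀+p₁+p₂) = thsum a₀ + 6t`, `0 ≤ t ≤ 1`) is within `√2/2 = 1/√2` of the model point `mv q` of a label `q` of ONE OF THE TWO LAYERS.

THE PROOF.  The bilayer lies in the fcc completion `F(c) = H + ℤc`, which is `3D₃ = {x ∈ (3ℤ)³ : Σx ∈ 6ℤ}` for `ε = 1` and its mirror image
`σ(3D₃)` (`σ` = the reflection negating `(1,1,−2)`, an isometry with `σ(H) = H`) for `ε = −1` (§1, `sig3`).  `D₃` is decoded by parity rounding
(Conway–Sloane, SPLAG ch. 4/20: round every coordinate; if the coordinate sum is odd, re-round the worst coordinate the other way): the squared error is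
`≤ (1 − e₁)² + e₂² + e₃² ≤ 1 − e₁(2 − 3e₁) ≤ 1` (`flip_ineq`), i.e. the covering radius of `D₃` is EXACTLY `1` (of `3D₃`: `3` integer units
`= 1/√2` model units), attained at the deep holes — so the margin `0.7247 > 0.7071` of `…Budget.lens_budget` is spent on the lens, none on the decoding.
SLAB LOCALISATION: `F(c)` meets only the planes `thsum ∈ 6ℤ` and `(ΣP − ΣV)² ≤ 3·|P − V|² ≤ 27 < 36`, so the decoded point of a point between the two
layers lies ON one of the two layers (never on an unlabelled layer of the completion).  §3: the lens point (`lens_point`), the level of a point of the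
`(24/5 − ρ₀)`-ball (`|level| ≤ 5`, `slab_budget`), and the coordinate placement `25·u_c² ≤ 6912 − 200ℓ²` of a label within `R′ = 24/5`
(the left-hand side of `…Budget.cover_A / cover_B`).  Pure lattice geometry: no numerics, no site data, no new hypothesis of the run.

Deps: tree only (`…CompressedCutPatch` for `capv`, `…CompressedCutBudget` for `coord_sq_le`; `…Seed.InLayer`; `…ChartsA.mv`).  No `instance`, no `notation`, no `set_option`, no new axioms, 0 sorry.
-/

namespace Summit.AtomisticToContinuum.Crystallization.Theorems.OverbindingBudgetAffineCompressedCutLens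

open Literature.Geometry.DiscreteGeometry (intVec intVec_apply)
open Summit.AtomisticToContinuum.Crystallization.Theorems.OverbindingBudgetAffineCompressedCutKernel (T3 tadd tsq thsum toV toV_apply_zero
  toV_apply_one toV_apply_two)
open Summit.AtomisticToContinuum.Crystallization.Theorems.OverbindingBudgetAffineCompressedCutCharts (mv norm_mv_sq)
open Summit.AtomisticToContinuum.Crystallization.Theorems.OverbindingBudgetAffineCompressedCutSeed (InLayer)
open Summit.AtomisticToContinuum.Crystallization.Theorems.OverbindingBudgetAffineCompressedCutPatch (capv)
open Summit.AtomisticToContinuum.Crystallization.Theorems.OverbindingBudgetAffineCompressedCutBudget (coord_sq_le)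

/-! ## §1  `D₃` parity decoding (covering radius `1`; for `3D₃` in integer units `3`) and the mirror completion -/

/-- The flip inequality: if `|e₁| ≤ 1/2` dominates `|e₂|` and `|e₃|`, then `(1 − |e₁|)² + e₂² + e₃² ≤ 1` (`= 1 − |e₁|(2 − 3|e₁|) + slack`). [this file] -/
theorem flip_ineq {e₁ e₂ e₃ : ℝ} (h₁ : |e₁| ≤ 1 / 2) (h₂ : |e₂| ≤ |e₁|) (h₃ : |e₃| ≤ |e₁|) :
    (1 - |e₁|) ^ 2 + e₂ ^ 2 + e₃ ^ 2 ≤ 1 := by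
  have a₁ := abs_nonneg e₁
  have q₂ : e₂ ^ 2 ≤ |e₁| ^ 2 := by
    rw [← sq_abs e₂]; exact pow_le_pow_left₀ (abs_nonneg _) h₂ 2
  have q₃ : e₃ ^ 2 ≤ |e₁| ^ 2 := by
    rw [← sq_abs e₃]; exact pow_le_pow_left₀ (abs_nonneg _) h₃ 2
  nlinarith

/-- Re-rounding one coordinate the other way: for `|t − r| ≤ 1/2` there is `r' = r ± 1` with `|t − r'| = 1 − |t − r|`. [this file] -/
theorem reround (t : ℝ) (r : ℤ) (h : |t - r| ≤ 1 / 2) : ∃ r' : ℤ, (r' = r + 1 ∨ r' = r - 1) ∧ |t - r'| = 1 - |t - r| := by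
  obtain ⟨hl, hu⟩ := abs_le.mp h
  rcases le_or_gt 0 (t - r) with h0 | h0
  · refine ⟨r + 1, Or.inl rfl, ?_⟩
    rw [abs_of_nonneg h0]
    push_cast
    rw [abs_of_nonpos (by linarith)]
    ring
  · refine ⟨r - 1, Or.inr rfl, ?_⟩
    rw [abs_of_neg h0]
    push_cast
    rw [abs_of_nonneg (by linarith)]
    ring

/-- Decoding when the FIRST coordinate carries the largest rounding error: a point of `D₃ = {u : Σu even}` at squared distance `≤ 1`. [this file] -/
theorem decode_dom (a b c : ℝ) (h₂ : |b - round b| ≤ |a - round a|) (h₃ : |c - round c| ≤ |a - round a|) :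
    ∃ u : T3, 2 ∣ thsum u ∧ (a - u.1) ^ 2 + (b - u.2.1) ^ 2 + (c - u.2.2) ^ 2 ≤ 1 := by
  have ea := abs_sub_round a
  have eb := abs_sub_round b
  have ec := abs_sub_round c
  by_cases hpar : 2 ∣ round a + round b + round c
  · refine ⟨(round a, round b, round c), hpar, ?_⟩
    have qa : (a - round a) ^ 2 ≤ (1 / 2) ^ 2 := by
      rw [← sq_abs]; exact pow_le_pow_left₀ (abs_nonneg _) ea 2
    have qb : (b - round b) ^ 2 ≤ (1 / 2) ^ 2 := by
      rw [← sq_abs]; exact pow_le_pow_left₀ (abs_nonneg _) eb 2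
    have qc : (c - round c) ^ 2 ≤ (1 / 2) ^ 2 := by
      rw [← sq_abs]; exact pow_le_pow_left₀ (abs_nonneg _) ec 2
    dsimp only
    linarith
  · obtain ⟨r', hr', habs⟩ := reround a (round a) ea
    refine ⟨(r', round b, round c), ?_, ?_⟩
    · dsimp only [thsum]
      rcases hr' with rfl | rfl <;> omega
    · have key := flip_ineq ea h₂ h₃
      have e1 : (a - r') ^ 2 = (1 - |a - round a|) ^ 2 := by rw [← sq_abs (a - r'), habs]
      dsimp only
      rw [e1]
      exact key

/-- ★ **`D₃` DECODING** (unit form): every point of `ℝ³` is at squared distance `≤ 1` from a point of `D₃` — the covering radius of `D₃` is `1`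
(deep holes `(1,0,0)`; Conway–Sloane, SPLAG ch. 4 §7.1 / ch. 20). [this file] -/
theorem d3_decode_unit (a b c : ℝ) : ∃ u : T3, 2 ∣ thsum u ∧ (a - u.1) ^ 2 + (b - u.2.1) ^ 2 + (c - u.2.2) ^ 2 ≤ 1 := by
  rcases le_total |b - round b| |a - round a| with hba | hab
  · rcases le_total |c - round c| |a - round a| with hca | hac
    · exact decode_dom a b c hba hca
    · obtain ⟨u, hu, h⟩ := decode_dom c a b hac (hba.trans hac)
      exact ⟨(u.2.1, u.2.2, u.1), by dsimp only [thsum] at hu ⊢; omega, by dsimp only at h ⊢; linarith⟩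
  · rcases le_total |c - round c| |b - round b| with hcb | hbc
    · obtain ⟨u, hu, h⟩ := decode_dom b a c hab hcb
      exact ⟨(u.2.1, u.1, u.2.2), by dsimp only [thsum] at hu ⊢; omega, by dsimp only at h ⊢; linarith⟩
    · obtain ⟨u, hu, h⟩ := decode_dom c a b (hab.trans hbc) hbc
      exact ⟨(u.2.1, u.2.2, u.1), by dsimp only [thsum] at hu ⊢; omega, by dsimp only at h ⊢; linarith⟩

/-- ★ **`3D₃` DECODING** (integer units of the model, `mv = ·/√18`): every point of `ℝ³` is at squared distance `≤ 9` from a point `3u`, `Σu` even,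
of the fcc lattice `3D₃ = H + ℤ(3,3,0)`. [this file] -/
theorem d3_decode (A B C : ℝ) : ∃ u : T3, 2 ∣ thsum u ∧ (A - 3 * u.1) ^ 2 + (B - 3 * u.2.1) ^ 2 + (C - 3 * u.2.2) ^ 2 ≤ 9 := by
  obtain ⟨u, hu, h⟩ := d3_decode_unit (A / 3) (B / 3) (C / 3)
  refine ⟨u, hu, ?_⟩
  have e : (A - 3 * u.1) ^ 2 + (B - 3 * u.2.1) ^ 2 + (C - 3 * u.2.2) ^ 2 =
      9 * ((A / 3 - u.1) ^ 2 + (B / 3 - u.2.1) ^ 2 + (C / 3 - u.2.2) ^ 2) := by ring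
  rw [e]
  linarith

/-- The mirror image `σ(3u)` of the point `3u` under the reflection `σ` negating `(1,1,−2)`: `σ(3u) = 3u − (u₁ + u₂ − 2u₃)(1,1,−2)`. [this file] -/
def sig3 (u : T3) : T3 :=
  (3 * u.1 - (u.1 + u.2.1 - 2 * u.2.2), 3 * u.2.1 - (u.1 + u.2.1 - 2 * u.2.2), 3 * u.2.2 + 2 * (u.1 + u.2.1 - 2 * u.2.2))

/-- ★ **DECODING IN THE MIRROR COMPLETION** `σ(3D₃) = H + ℤ(1,1,4)`: every point of `ℝ³` is at squared distance `≤ 9` from a point `σ(3u)`, `Σu` even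
(decode `σP` in `3D₃` and reflect back; `σ` is an involutive isometry). [this file] -/
theorem d3_decode_mirror (A B C : ℝ) :
    ∃ u : T3, 2 ∣ thsum u ∧ (A - (sig3 u).1) ^ 2 + (B - (sig3 u).2.1) ^ 2 + (C - (sig3 u).2.2) ^ 2 ≤ 9 := by
  obtain ⟨u, hu, h⟩ := d3_decode (A - (A + B - 2 * C) / 3) (B - (A + B - 2 * C) / 3) (C + 2 * ((A + B - 2 * C) / 3))
  refine ⟨u, hu, ?_⟩
  have e : (A - ((sig3 u).1 : ℝ)) ^ 2 + (B - ((sig3 u).2.1 : ℝ)) ^ 2 + (C - ((sig3 u).2.2 : ℝ)) ^ 2 =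
      (A - (A + B - 2 * C) / 3 - 3 * u.1) ^ 2 + (B - (A + B - 2 * C) / 3 - 3 * u.2.1) ^ 2 + (C + 2 * ((A + B - 2 * C) / 3) - 3 * u.2.2) ^ 2 := by
    simp only [sig3]
    push_cast
    ring
  rw [e]
  exact h

/-! ## §2  Model points, the slab, and the LENS LEMMA -/

/-- `‖p − mv q‖²` in coordinates (integer units `√18·p`). [this file] -/
theorem norm_sub_mv_sq (p : EuclideanSpace ℝ (Fin 3)) (q : T3) :
    ‖p - mv q‖ ^ 2 = ((Real.sqrt 18 * p 0 - q.1) ^ 2 + (Real.sqrt 18 * p 1 - q.2.1) ^ 2 + (Real.sqrt 18 * p 2 - q.2.2) ^ 2) / 18 := by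
  have h18 : Real.sqrt 18 ^ 2 = 18 := Real.sq_sqrt (by norm_num)
  have hs : Real.sqrt 18 ≠ 0 := Real.sqrt_ne_zero'.2 (by norm_num)
  rw [EuclideanSpace.norm_eq, Real.sq_sqrt (Finset.sum_nonneg fun _ _ => sq_nonneg _), Fin.sum_univ_three]
  simp only [mv, PiLp.sub_apply, PiLp.smul_apply, intVec_apply, toV_apply_zero, toV_apply_one, toV_apply_two, smul_eq_mul,
    Real.norm_eq_abs, sq_abs]
  field_simp
  rw [h18]
  ring

/-- `(p₀ + p₁ + p₂)² ≤ 3‖p‖²` (Cauchy–Schwarz against `(1,1,1)`). [this file] -/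
theorem sum_sq_le_three_norm_sq (p : EuclideanSpace ℝ (Fin 3)) : (p 0 + p 1 + p 2) ^ 2 ≤ 3 * ‖p‖ ^ 2 := by
  rw [EuclideanSpace.norm_eq, Real.sq_sqrt (Finset.sum_nonneg fun _ _ => sq_nonneg _), Fin.sum_univ_three]
  simp only [Real.norm_eq_abs, sq_abs]
  nlinarith [sq_nonneg (p 0 - p 1), sq_nonneg (p 1 - p 2), sq_nonneg (p 0 - p 2)]

/-- SLAB LOCALISATION (integer form): if `ΣP = 6t` with `0 ≤ t ≤ 1` and `V` (with `ΣV = 6t'`, `t' ∈ ℤ`) is within squared distance `9` of `P`, then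
`t' = 0 ∨ t' = 1` — `(ΣP − ΣV)² ≤ 3·9 = 27 < 36`. [this file] -/
theorem slab_int {P₁ P₂ P₃ V₁ V₂ V₃ t : ℝ} {t' : ℤ} (ht0 : 0 ≤ t) (ht1 : t ≤ 1) (hP : P₁ + P₂ + P₃ = 6 * t) (hV : V₁ + V₂ + V₃ = 6 * t')
    (hd : (P₁ - V₁) ^ 2 + (P₂ - V₂) ^ 2 + (P₃ - V₃) ^ 2 ≤ 9) : t' = 0 ∨ t' = 1 := by
  have cs : (P₁ + P₂ + P₃ - (V₁ + V₂ + V₃)) ^ 2 ≤ 3 * ((P₁ - V₁) ^ 2 + (P₂ - V₂) ^ 2 + (P₃ - V₃) ^ 2) := by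
    nlinarith [sq_nonneg (P₁ - V₁ - (P₂ - V₂)), sq_nonneg (P₂ - V₂ - (P₃ - V₃)), sq_nonneg (P₁ - V₁ - (P₃ - V₃))]
  rw [hP, hV] at cs
  have h36 : 36 * (t - t') ^ 2 ≤ 27 := by nlinarith
  have hlt : (t' : ℝ) < 2 := by nlinarith
  have hgt : (-1 : ℝ) < t' := by nlinarith
  have i1 : t' < 2 := by exact_mod_cast hlt
  have i2 : -1 < t' := by exact_mod_cast hgt
  omega

/-- ★★ **THE LENS LEMMA.**  Consecutive labelled layers `a₀ + H` and `a₀ + c + H`, `c = capv 1 ε (1,1,−2)`, `ε = ±1`; a model point `p` at height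
`√18·(p₀+p₁+p₂) = thsum a₀ + 6t`, `0 ≤ t ≤ 1` (between the two layers).  Then some label `q` of ONE OF THE TWO LAYERS has `‖p − mv q‖² ≤ 1/2`. [this file] -/
theorem lens (a₀ : T3) {ε : ℤ} (hε : ε = 1 ∨ ε = -1) (p : EuclideanSpace ℝ (Fin 3)) {t : ℝ} (ht0 : 0 ≤ t) (ht1 : t ≤ 1)
    (hh : Real.sqrt 18 * (p 0 + p 1 + p 2) = thsum a₀ + 6 * t) :
    ∃ q x : T3, InLayer x ∧ (q = tadd a₀ x ∨ q = tadd (tadd a₀ (capv 1 ε (1, 1, -2))) x) ∧ ‖p - mv q‖ ^ 2 ≤ 1 / 2 := by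
  -- integer-unit coordinates relative to `a₀`
  set P₁ : ℝ := Real.sqrt 18 * p 0 - a₀.1 with hP₁
  set P₂ : ℝ := Real.sqrt 18 * p 1 - a₀.2.1 with hP₂
  set P₃ : ℝ := Real.sqrt 18 * p 2 - a₀.2.2 with hP₃
  have hP : P₁ + P₂ + P₃ = 6 * t := by
    have e : (thsum a₀ : ℝ) = a₀.1 + a₀.2.1 + a₀.2.2 := by simp only [thsum]; push_cast; ring
    rw [hP₁, hP₂, hP₃]; linarith
  -- the conclusion from a decoded point `V = t'c + x` with `x ∈ H`, `t' ∈ {0,1}`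
  have finish : ∀ (V : T3) (t' : ℤ), (t' = 0 ∨ t' = 1) → InLayer (V.1 - t' * (2 + ε), V.2.1 - t' * (2 + ε), V.2.2 - t' * (2 - 2 * ε)) →
      (P₁ - V.1) ^ 2 + (P₂ - V.2.1) ^ 2 + (P₃ - V.2.2) ^ 2 ≤ 9 →
      ∃ q x : T3, InLayer x ∧ (q = tadd a₀ x ∨ q = tadd (tadd a₀ (capv 1 ε (1, 1, -2))) x) ∧ ‖p - mv q‖ ^ 2 ≤ 1 / 2 := by
    intro V t' ht' hx hd
    refine ⟨tadd a₀ V, (V.1 - t' * (2 + ε), V.2.1 - t' * (2 + ε), V.2.2 - t' * (2 - 2 * ε)), hx, ?_, ?_⟩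
    · rcases ht' with rfl | rfl
      · left; simp only [tadd, Prod.mk.injEq]; exact ⟨by ring, by ring, by ring⟩
      · right; simp only [tadd, capv, Prod.mk.injEq]; exact ⟨by ring, by ring, by ring⟩
    · rw [norm_sub_mv_sq]
      have e : (Real.sqrt 18 * p 0 - ((tadd a₀ V).1 : ℝ)) ^ 2 + (Real.sqrt 18 * p 1 - ((tadd a₀ V).2.1 : ℝ)) ^ 2 +
          (Real.sqrt 18 * p 2 - ((tadd a₀ V).2.2 : ℝ)) ^ 2 = (P₁ - V.1) ^ 2 + (P₂ - V.2.1) ^ 2 + (P₃ - V.2.2) ^ 2 := by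
        rw [hP₁, hP₂, hP₃]; simp only [tadd]; push_cast; ring
      rw [e]
      linarith
  rcases hε with rfl | rfl
  · -- `c = (3,3,0)`: the completion is `3D₃` itself
    obtain ⟨u, hu, hd⟩ := d3_decode P₁ P₂ P₃
    obtain ⟨t', ht'⟩ := hu
    simp only [thsum] at ht'
    have hV : (3 * (u.1 : ℝ)) + 3 * u.2.1 + 3 * u.2.2 = 6 * t' := by
      have e : (u.1 : ℝ) + u.2.1 + u.2.2 = 2 * t' := by exact_mod_cast ht'
      linarith
    have ht01 := slab_int ht0 ht1 hP hV hd
    refine finish (3 * u.1, 3 * u.2.1, 3 * u.2.2) t' ht01 ⟨?_, ?_, ?_⟩ (by dsimp only; push_cast; exact hd)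
    · dsimp only; linarith
    · exact ⟨u.1 - t', by dsimp only; ring⟩
    · exact ⟨u.2.1 - t', by dsimp only; ring⟩
  · -- `c = (1,1,4)`: the completion is the mirror image `σ(3D₃)`
    obtain ⟨u, hu, hd⟩ := d3_decode_mirror P₁ P₂ P₃
    obtain ⟨t', ht'⟩ := hu
    simp only [thsum] at ht'
    have hV : ((sig3 u).1 : ℝ) + (sig3 u).2.1 + (sig3 u).2.2 = 6 * t' := by
      have e : (u.1 : ℝ) + u.2.1 + u.2.2 = 2 * t' := by exact_mod_cast ht'
      simp only [sig3]; push_cast; linarith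
    have ht01 := slab_int ht0 ht1 hP hV hd
    refine finish (sig3 u) t' ht01 ⟨?_, ?_, ?_⟩ hd
    · dsimp only [sig3]; linarith
    · exact ⟨u.1 + u.2.2 - t', by dsimp only [sig3]; linarith⟩
    · exact ⟨u.2.1 + u.2.2 - t', by dsimp only [sig3]; linarith⟩

/-- The lens lemma with the distance in the form used by O7: `‖p − mv q‖ ≤ √2/2`. [this file] -/
theorem lens_dist (a₀ : T3) {ε : ℤ} (hε : ε = 1 ∨ ε = -1) (p : EuclideanSpace ℝ (Fin 3)) {t : ℝ} (ht0 : 0 ≤ t) (ht1 : t ≤ 1)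
    (hh : Real.sqrt 18 * (p 0 + p 1 + p 2) = thsum a₀ + 6 * t) :
    ∃ q x : T3, InLayer x ∧ (q = tadd a₀ x ∨ q = tadd (tadd a₀ (capv 1 ε (1, 1, -2))) x) ∧ ‖p - mv q‖ ≤ Real.sqrt 2 / 2 := by
  obtain ⟨q, x, hx, hq, hd⟩ := lens a₀ hε p ht0 ht1 hh
  refine ⟨q, x, hx, hq, ?_⟩
  have h2 : Real.sqrt 2 ^ 2 = 2 := Real.sq_sqrt (by norm_num)
  by_contra hlt
  push Not at hlt
  have h0 : 0 ≤ Real.sqrt 2 / 2 := by positivity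
  have hm := mul_lt_mul'' hlt hlt h0 h0
  nlinarith [norm_nonneg (p - mv q)]

/-! ## §3  The lens point, its level, and the coordinate placement of labels within `R′ = 24/5` -/

/-- The lens radius `ρ₀ = (9/10 + 24/5 − (106/25)(400/399))/2` of `…Budget.lens_budget` (`> √2/2`). [this file] -/
noncomputable def rho0 : ℝ := (9 / 10 + 24 / 5 - 106 / 25 * (400 / 399)) / 2

/-- ★ **THE LENS POINT.**  For `‖z‖ ≤ (106/25)(400/399)` there is `c` with `‖c‖ ≤ 24/5 − ρ₀` and `‖z − c‖ ≤ 9/10 − ρ₀`: the ball `B(c, ρ₀)` lies in the lens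
`B(z, 9/10) ∩ B(0, 24/5)` (take `c` on the segment `[0, z]`). [this file] -/
theorem lens_point (z : EuclideanSpace ℝ (Fin 3)) (hz : ‖z‖ ≤ 106 / 25 * (400 / 399)) :
    ∃ c : EuclideanSpace ℝ (Fin 3), ‖c‖ ≤ 24 / 5 - rho0 ∧ ‖z - c‖ ≤ 9 / 10 - rho0 := by
  have hK : 24 / 5 - rho0 + (9 / 10 - rho0) = 106 / 25 * (400 / 399) := by simp only [rho0]; ring
  have hpos : 0 < 24 / 5 - rho0 := by simp only [rho0]; norm_num
  by_cases hs : ‖z‖ ≤ 24 / 5 - rho0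
  · refine ⟨z, hs, ?_⟩
    rw [sub_self, norm_zero]; simp only [rho0]; norm_num
  · push Not at hs
    have hz0 : 0 < ‖z‖ := hpos.trans hs
    refine ⟨((24 / 5 - rho0) / ‖z‖) • z, ?_, ?_⟩
    · rw [norm_smul, Real.norm_of_nonneg (by positivity), div_mul_cancel₀ _ hz0.ne']
    · have e : z - ((24 / 5 - rho0) / ‖z‖) • z = (1 - (24 / 5 - rho0) / ‖z‖) • z := by rw [sub_smul, one_smul]
      have hc : 0 ≤ 1 - (24 / 5 - rho0) / ‖z‖ := by
        rw [sub_nonneg, div_le_one hz0]; exact hs.le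
      rw [e, norm_smul, Real.norm_of_nonneg hc, sub_mul, one_mul, div_mul_cancel₀ _ hz0.ne']
      linarith

/-- `√2/2 < ρ₀` (restated from `…Budget.lens_budget` in this file's name). [this file] -/
theorem sqrt_two_div_two_lt_rho0 : Real.sqrt 2 / 2 < rho0 := by
  have h : Real.sqrt 2 < 1415 / 1000 := by
    rw [Real.sqrt_lt' (by norm_num)]; norm_num
  simp only [rho0]; linarith

/-- **SLAB BUDGET**: `54·(24/5 − ρ₀)² < 900`, i.e. `√54·‖c‖ < 30` for the lens point — its height `√18·(c₀+c₁+c₂)` lies strictly between the levels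
`±5` (`6·(±5)`), so `c` sits between two consecutive layers of level in `[−5, 5]` (cf. `…Budget.cover_B_top`). [this file] -/
theorem slab_budget : 54 * (24 / 5 - rho0) ^ 2 < 900 := by
  simp only [rho0]; norm_num

/-- ★ **LEVEL OF A POINT OF THE `(24/5 − ρ₀)`-BALL**: `√18·(c₀+c₁+c₂) = 6ℓ + 6t` with `ℓ ∈ [−5, 4]`, `0 ≤ t ≤ 1`. [this file] -/
theorem level_of_point (c : EuclideanSpace ℝ (Fin 3)) (hc : ‖c‖ ≤ 24 / 5 - rho0) :
    ∃ (ℓ : ℤ) (t : ℝ), -5 ≤ ℓ ∧ ℓ ≤ 4 ∧ 0 ≤ t ∧ t ≤ 1 ∧ Real.sqrt 18 * (c 0 + c 1 + c 2) = 6 * ℓ + 6 * t := by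
  have h18 : Real.sqrt 18 ^ 2 = 18 := Real.sq_sqrt (by norm_num)
  have hsq : (Real.sqrt 18 * (c 0 + c 1 + c 2)) ^ 2 < 30 ^ 2 := by
    have h1 := sum_sq_le_three_norm_sq c
    have h2 : ‖c‖ ^ 2 ≤ (24 / 5 - rho0) ^ 2 := pow_le_pow_left₀ (norm_nonneg _) hc 2
    have h3 := slab_budget
    nlinarith
  obtain ⟨hlo, hhi⟩ := abs_lt_of_sq_lt_sq' hsq (by norm_num)
  refine ⟨⌊Real.sqrt 18 * (c 0 + c 1 + c 2) / 6⌋, Real.sqrt 18 * (c 0 + c 1 + c 2) / 6 - ⌊Real.sqrt 18 * (c 0 + c 1 + c 2) / 6⌋,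
    ?_, ?_, ?_, ?_, ?_⟩
  · exact Int.le_floor.mpr (by push_cast; linarith)
  · have : ⌊Real.sqrt 18 * (c 0 + c 1 + c 2) / 6⌋ < (5 : ℤ) := Int.floor_lt.mpr (by push_cast; linarith)
    omega
  · linarith [Int.floor_le (Real.sqrt 18 * (c 0 + c 1 + c 2) / 6)]
  · linarith [Int.lt_floor_add_one (Real.sqrt 18 * (c 0 + c 1 + c 2) / 6)]
  · ring

/-- ★ **COORDINATE PLACEMENT.**  A label `(2ℓ,2ℓ,2ℓ) + u` with `Σu = 0` (level `ℓ`, in-level part `u = offs + x`) whose model point lies within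
`R′ = 24/5` has `25·u_c² ≤ 6912 − 200ℓ²` for every coordinate `c` (`12R′² = 6912/25`; `u_c² ≤ (2/3)·tsq u`, `…Budget.coord_sq_le`) — the left-hand
side of `…Budget.cover_A / cover_B`; and `|ℓ| ≤ 5` (`…Budget.cover_B_top`). [this file] -/
theorem placement {ℓ : ℤ} {u : T3} (hu : thsum u = 0) (hR : ‖mv (tadd (2 * ℓ, 2 * ℓ, 2 * ℓ) u)‖ ≤ 24 / 5) :
    25 * u.1 ^ 2 ≤ 6912 - 200 * ℓ ^ 2 ∧ 25 * u.2.1 ^ 2 ≤ 6912 - 200 * ℓ ^ 2 ∧ 25 * u.2.2 ^ 2 ≤ 6912 - 200 * ℓ ^ 2 ∧ |ℓ| ≤ 5 := by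
  have hn := norm_mv_sq (tadd (2 * ℓ, 2 * ℓ, 2 * ℓ) u)
  have hsq : ‖mv (tadd (2 * ℓ, 2 * ℓ, 2 * ℓ) u)‖ ^ 2 ≤ (24 / 5) ^ 2 := pow_le_pow_left₀ (norm_nonneg _) hR 2
  have ht : (tsq (tadd (2 * ℓ, 2 * ℓ, 2 * ℓ) u) : ℝ) = 12 * ℓ ^ 2 + tsq u := by
    have e : tsq (tadd (2 * ℓ, 2 * ℓ, 2 * ℓ) u) = 12 * ℓ ^ 2 + tsq u := by
      simp only [tsq, tadd, thsum] at hu ⊢; linear_combination (4 * ℓ) * hu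
    exact_mod_cast e
  have key : (25 : ℝ) * tsq u ≤ 10368 - 300 * ℓ ^ 2 := by
    rw [hn, ht] at hsq; nlinarith
  have keyZ : 25 * tsq u ≤ 10368 - 300 * ℓ ^ 2 := by exact_mod_cast key
  obtain ⟨c1, c2, c3⟩ := coord_sq_le hu
  have hℓ : ℓ ^ 2 ≤ 34 := by
    have h0 : (0 : ℤ) ≤ tsq u := by
      simp only [tsq]; nlinarith [mul_self_nonneg u.1, mul_self_nonneg u.2.1, mul_self_nonneg u.2.2]
    nlinarith
  refine ⟨by nlinarith, by nlinarith, by nlinarith, ?_⟩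
  rw [abs_le]
  constructor <;> nlinarith [sq_nonneg (ℓ + 6), sq_nonneg (ℓ - 6)]

end Summit.AtomisticToContinuum.Crystallization.Theorems.OverbindingBudgetAffineCompressedCutLens
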